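import Summits.ABC.IUTFork.Cor312VolumesRealAssembly
import HarnessLib

/-!
# [IUTchIII] Cor. 3.12, TEAM B — the single-Haar «Iff» reading of the capstone is UNSATISFIABLE at
# the assembled real setting: direct-product admissibility is not the positive-finite class of any
# Haar measure

Record-only file (D-0012) of the abc-iut cell (Cor. 3.12 strategy TEAM B «estimate / log-Kummer» of
HUMAN RULING D-0067 (3), seat abc-iut-c312-11 = B1, gen 6); PROOF-ONLY (0 defs); TAKES NO SIDE.

This file CLOSES (negatively, as typed) the last named TEAM B residual of the RESULT kit
(`staging/c312/c312-11/RESULT-1130Z-KIT.md` l. 43–47, re-affirmed in the B crib Q7): whether the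
abstract TEAM B capstone `Cor312Vol.teamB_capstone_of_latticeRealisations` (p413800) — whose
interface READS the mono-analytic volumes through a SINGLE-Haar container, binder
`hAdm : ∀ j v_ℚ A, Adm j v_ℚ A ↔ 0 < μ_Λ(e''A) ∧ μ_Λ(e''A) < ⊤` — can be instantiated at the
ASSEMBLED real setting `Thm311.Real.situationDHVol` (c312-5's situation over the real Dupuy–Hilado
log-shells with the VERBATIM all-places container, `Cor312VolumesRealAssembly`). It cannot:

* the verbatim container admissibility of [IUTchIII] Rmk. 3.1.1 (iii) (kurims
  `paper:url-4b091feeb646` p. 95 l. 28–30: a region is admissible iff its image in `Π_{v⃗} M_{v⃗}` is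
  "a direct product of compact subsets of positive measure in each of the direct summands",
  `SummandPieces.Adm`) is **NOT closed under binary unions** as soon as one packet has TWO distinct
  summands carrying two incomparable admissible factor sets (`SummandPieces.not_adm_union_preimage_pi`,
  from the pure product-set obstruction `union_univ_pi_ne_univ_pi`);
* while ANY single-Haar «Iff» reading of the same `Adm` — through ANY carrier family `W`, ANY
  integral structures `Λ`, ANY comparison maps `e` (the capstone's own instance context) — forces
  union-closure, by monotonicity and subadditivity of the Haar measure
  (`adm_union_of_singleHaarAdm`);
* hence over any line datum realizing a container with such a "rich" packet there is NO single-Haar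
  reading at all (`SummandPieces.not_singleHaarAdm_of_realizes`), and at the real assembled setting
  the richness is a THEOREM whenever some rational prime carries at least two places of `F`
  (`Thm311.Real.not_singleHaarAdm_situationDHVol`; the two summands are the two constant tuples
  `v⃗ = (v₁, …, v₁)`, `(v₂, …, v₂)`, the incomparable factor sets are the normalised integral tensor
  packet `(R_I)^∼` ([IUTchIV] Prop. 1.4 (i) p. 13; Dupuy–Hilado §2.4.5) and a disjoint additive
  translate of it). Genuine initial Θ-data have `F ⊋ ℚ` ([IUTchI] Def. 3.1), for which rational
  primes with `≥ 2` places over them exist in abundance (split primes; Chebotarev) — the hypothesis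
  is carried explicitly and discharged by the instance lanes, not here.

CONSEQUENCE for the TEAM B record (nothing reopened, the B line of record 10:21:46Z stands): at the
real setting the correct — and the only possible — capstone-granularity interface is the
REALISED-container one (`Cor312TeamBCapstoneRealDH` p415747, `Cor312TeamBCapstoneSettingDHVol`
p417670: the container is realised, not read), exactly as those files state; the single-Haar «Iff»
reading applies to honest single-Haar situations (the capstone-witness instantiations
`Cor312CapstoneWitness` p416604/p416831 over `W = ZMod 4`), NOT to the assembled verbatim container.
The kit residual list `{hAdm (single-container Iff) / hthetaEq / hR at capstone granularity at the
assembled real setting}` therefore closes: `hAdm` is unsatisfiable there (this file), and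
`hthetaEq`/`hR` are moot at capstone granularity while already discharged at route granularity
(reference region = the `m = 0` Kummer image, p417670). Sources read on the page (kurims
`paper:url-4b091feeb646`): [IUTchIII] Rmk. 3.1.1 (ii)(iii) pp. 94–96, Prop. 3.9 (i) pp. 115–116,
Cor. 3.12 pp. 173–174; [IUTchIV] Prop. 1.4 (i) p. 13. [claim: Mochizuki2012, status: disputed]
[cite: DupuyHilado2025, §2.4.5, §3.4, Def. 3.6.1]
Deliberately NOT here: any judgement on [IUTchIII] Cor. 3.12 or the gap input
`Cor312Vol.GlobalVolumeTransport` (G-c312-11-1), any new `Prop`/definition, the archimedean factors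
(the obstruction needs one nonarchimedean place only), any statement about WHICH reading print
intends — typed ≠ proved; no side taken.
-/

noncomputable section

open Set Function MeasureTheory NumberField
open scoped Pointwise ENNReal

namespace Summit.ABC

namespace IUTFork

namespace Cor312Vol

open Thm311 Literature.IUT.LogThetaLattice Literature.IUT.LogVolume

variable {T : ThetaIndex}

/-! ## 1. A union of two direct products is not a direct product (two incomparable coordinates)

Pure product-set bookkeeping: if `R₁`, `R₂` are nonempty-factor families over an index `E` and at
two DISTINCT indices `e₁ ≠ e₂` the factors are incomparable in opposite directions
(`R₁ e₁ ⊄ R₂ e₁` and `R₂ e₂ ⊄ R₁ e₂`), then `Π R₁ ∪ Π R₂` is not of the form `Π R` for ANY `R`: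
the mixed point (coordinates of `Π R₁` away from `e₂`, the `R₂`-witness at `e₂`) would lie in the
product but in neither term. [folklore] -/

/-- **Unions of direct products are not direct products** (two incomparable coordinates): for
`e₁ ≠ e₂`, factor families `R₁, R₂` with all factors nonempty, a point of `R₁ e₁ \ R₂ e₁` and a
point of `R₂ e₂ \ R₁ e₂`, no family `R` has `Π_E R₁ ∪ Π_E R₂ = Π_E R`. [folklore] -/
theorem union_univ_pi_ne_univ_pi {E : Type*} {X : E → Type*} {e₁ e₂ : E} (h12 : e₁ ≠ e₂)
    {R₁ R₂ : ∀ e, Set (X e)} (hne₁ : ∀ e, (R₁ e).Nonempty) (hne₂ : ∀ e, (R₂ e).Nonempty)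
    (hs : (R₁ e₁ \ R₂ e₁).Nonempty) (ht : (R₂ e₂ \ R₁ e₂).Nonempty) (R : ∀ e, Set (X e)) :
    Set.pi univ R₁ ∪ Set.pi univ R₂ ≠ Set.pi univ R := by
  classical
  obtain ⟨s₁, hs₁, hs₁'⟩ := hs
  obtain ⟨t₂, ht₂, ht₂'⟩ := ht
  intro hR
  set x : ∀ e, X e := Function.update (fun e => (hne₁ e).some) e₁ s₁ with hxdef
  set y : ∀ e, X e := Function.update (fun e => (hne₂ e).some) e₂ t₂ with hydef
  have hxmem : x ∈ Set.pi univ R₁ := by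
    intro e _
    rcases eq_or_ne e e₁ with rfl | he
    · rw [hxdef, Function.update_self]; exact hs₁
    · rw [hxdef, Function.update_of_ne he]; exact (hne₁ e).some_mem
  have hymem : y ∈ Set.pi univ R₂ := by
    intro e _
    rcases eq_or_ne e e₂ with rfl | he
    · rw [hydef, Function.update_self]; exact ht₂
    · rw [hydef, Function.update_of_ne he]; exact (hne₂ e).some_mem
  have hxR : x ∈ Set.pi univ R := by rw [← hR]; exact Or.inl hxmem
  have hyR : y ∈ Set.pi univ R := by rw [← hR]; exact Or.inr hymem
  have hzR : Function.update x e₂ t₂ ∈ Set.pi univ R := by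
    intro e _
    rcases eq_or_ne e e₂ with rfl | he
    · rw [Function.update_self]
      have hy2 := hyR e (mem_univ _)
      rwa [hydef, Function.update_self] at hy2
    · rw [Function.update_of_ne he]; exact hxR e (mem_univ _)
  have hzmem : Function.update x e₂ t₂ ∈ Set.pi univ R₁ ∪ Set.pi univ R₂ := by
    rw [hR]; exact hzR
  rcases hzmem with h | h
  · have h2 := h e₂ (mem_univ _)
    rw [Function.update_self] at h2
    exact ht₂' h2
  · have h1 := h e₁ (mem_univ _)
    rw [Function.update_of_ne h12, hxdef, Function.update_self] at h1
    exact hs₁' h1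

/-! ## 2. The verbatim container admissibility is not closed under binary unions -/

/-- **The verbatim `𝕄(𝓘^ℚ(−))` is NOT union-closed at a rich packet**: two distinct summands
`e₁ ≠ e₂` at `(j, v_ℚ)` with admissible factor families `R₁`, `R₂` incomparable in opposite
directions give two admissible regions (`SummandPieces.adm_preimage_pi`) whose UNION is not
admissible — its image `Π R₁ ∪ Π R₂` is not "a direct product of compact subsets of positive
measure in each of the direct summands" ([IUTchIII] Rmk. 3.1.1 (iii) p. 95 l. 28–30) for any choice
of factors. [claim: Mochizuki2012, status: disputed] -/
theorem SummandPieces.not_adm_union_preimage_pi {L : LogShells T} (V : SummandPieces L)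
    {j : T.Label} {vQ : T.VQ} {e₁ e₂ : V.E j vQ} (h12 : e₁ ≠ e₂)
    {R₁ R₂ : ∀ e, Set (V.X j vQ e)} (hadm₁ : ∀ e, V.adm j vQ e (R₁ e))
    (hadm₂ : ∀ e, V.adm j vQ e (R₂ e)) (hs : (R₁ e₁ \ R₂ e₁).Nonempty)
    (ht : (R₂ e₂ \ R₁ e₂).Nonempty) :
    ¬ V.Adm j vQ (V.e j vQ ⁻¹' Set.pi univ R₁ ∪ V.e j vQ ⁻¹' Set.pi univ R₂) := by
  rintro ⟨R, hR, -⟩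
  rw [image_union, image_preimage_eq _ (V.e_surjective j vQ),
    image_preimage_eq _ (V.e_surjective j vQ)] at hR
  exact union_univ_pi_ne_univ_pi h12 (fun e => V.adm_nonempty j vQ e _ (hadm₁ e))
    (fun e => V.adm_nonempty j vQ e _ (hadm₂ e)) hs ht R hR

/-! ## 3. Any single-Haar «Iff» reading forces union-closure -/

/-- **A single-Haar «Iff» reading of the admissibility is union-closed**: if some carrier family
`W`, integral structures `Λ` and comparisons `e` (the instance context of
`teamB_capstone_of_latticeRealisations`, p413800) satisfy the capstone's `hAdm` binder
`Adm j v_ℚ A ↔ 0 < μ_Λ(e''A) ∧ μ_Λ(e''A) < ⊤`, then admissibility is closed under binary unions —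
`e''(A ∪ B) = e''A ∪ e''B`, positivity by monotonicity, finiteness by subadditivity of the measure
`Λ.haar`. [folklore] -/
theorem adm_union_of_singleHaarAdm {L : LogShells T} {D : MRData L}
    {W : T.Label → T.VQ → Type*} [∀ j vQ, AddCommGroup (W j vQ)]
    [∀ j vQ, TopologicalSpace (W j vQ)] [∀ j vQ, IsTopologicalAddGroup (W j vQ)]
    [∀ j vQ, MeasurableSpace (W j vQ)] [∀ j vQ, BorelSpace (W j vQ)]
    {Λ : ∀ j vQ, IntegralStructure (W j vQ)} {e : ∀ j vQ, L.Packet j vQ → W j vQ}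
    (hAdm : ∀ (j : T.Label) (vQ : T.VQ) (A : Set (L.Packet j vQ)),
      D.Adm j vQ A ↔ 0 < (Λ j vQ).haar (e j vQ '' A) ∧ (Λ j vQ).haar (e j vQ '' A) < ⊤)
    {j : T.Label} {vQ : T.VQ} {A B : Set (L.Packet j vQ)} (hA : D.Adm j vQ A)
    (hB : D.Adm j vQ B) : D.Adm j vQ (A ∪ B) := by
  rw [hAdm] at hA hB ⊢
  rw [image_union]
  exact ⟨lt_of_lt_of_le hA.1 (measure_mono subset_union_left),
    lt_of_le_of_lt (measure_union_le _ _) (ENNReal.add_lt_top.2 ⟨hA.2, hB.2⟩)⟩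

/-! ## 4. Headline, abstract: no single-Haar reading over a realized container with a rich packet -/

/-- **No single-Haar «Iff» reading exists over a realized rich container**: if the line datum `D`
carries the verbatim volumes of a container `V` (`Realizes`, as at every line of
`Thm311.Real.situationDHVol`) and one packet of `V` has two distinct summands with incomparable
admissible factors, then NO carrier family `W`, integral structures `Λ` and comparisons `e`
whatsoever satisfy the capstone's `hAdm` binder for `D`: the reading would force union-closure
(§ 3) which the container refutes (§ 2). [claim: Mochizuki2012, status: disputed] -/
theorem SummandPieces.not_singleHaarAdm_of_realizes {L : LogShells T} {V : SummandPieces L}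
    {D : MRData L} (hD : V.Realizes D) {j : T.Label} {vQ : T.VQ} {e₁ e₂ : V.E j vQ}
    (h12 : e₁ ≠ e₂) {R₁ R₂ : ∀ e, Set (V.X j vQ e)} (hadm₁ : ∀ e, V.adm j vQ e (R₁ e))
    (hadm₂ : ∀ e, V.adm j vQ e (R₂ e)) (hs : (R₁ e₁ \ R₂ e₁).Nonempty)
    (ht : (R₂ e₂ \ R₁ e₂).Nonempty) (W : T.Label → T.VQ → Type*)
    [∀ j vQ, AddCommGroup (W j vQ)] [∀ j vQ, TopologicalSpace (W j vQ)]
    [∀ j vQ, IsTopologicalAddGroup (W j vQ)] [∀ j vQ, MeasurableSpace (W j vQ)]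
    [∀ j vQ, BorelSpace (W j vQ)] (Λ : ∀ j vQ, IntegralStructure (W j vQ))
    (e : ∀ j vQ, L.Packet j vQ → W j vQ) :
    ¬ (∀ (j : T.Label) (vQ : T.VQ) (A : Set (L.Packet j vQ)),
      D.Adm j vQ A ↔ 0 < (Λ j vQ).haar (e j vQ '' A) ∧ (Λ j vQ).haar (e j vQ '' A) < ⊤) := by
  intro hAdm
  have hA : D.Adm j vQ (V.e j vQ ⁻¹' Set.pi univ R₁) :=
    (hD.adm_iff _ _ _).2 (V.adm_preimage_pi j vQ hadm₁)
  have hB : D.Adm j vQ (V.e j vQ ⁻¹' Set.pi univ R₂) :=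
    (hD.adm_iff _ _ _).2 (V.adm_preimage_pi j vQ hadm₂)
  have hAB := adm_union_of_singleHaarAdm hAdm hA hB
  exact V.not_adm_union_preimage_pi h12 hadm₁ hadm₂ hs ht ((hD.adm_iff _ _ _).1 hAB)

/-! ## 5. Translate bookkeeping at the real tensor packets

The rich factors at the real prime packets: the normalised integral tensor packet `(R_I)^∼`
([IUTchIV] Prop. 1.4 (i) p. 13; Dupuy–Hilado §2.4.5, `normalizedPacket`, admissible of volume `1`)
and a DISJOINT additive translate of it. The three lemmas are generic in the field family `k`. -/

section PacketTranslate

variable (p : ℕ) [Fact p.Prime] {I : Type} [Fintype I] [DecidableEq I] (k : I → Type)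
  [∀ i, NontriviallyNormedField (k i)] [∀ i, NormedAlgebra ℚ_[p] (k i)]
  [∀ i, IsUltrametricDist (k i)] [∀ i, ProperSpace (k i)]

omit [DecidableEq I] [∀ (i : I), IsUltrametricDist (k i)] in
/-- The packet volume is translation-invariant: `μ(z + A) = μ(A)` (the chosen decomposition `ψ` is
additive, and `μ_{Π O_{L_j}}` is a Haar measure). [folklore] -/
theorem packetVol_vadd (z : PacketAlgebra p k) (A : Set (PacketAlgebra p k)) :
    packetVol p k (z +ᵥ A) = packetVol p k A := by
  unfold packetVol
  have himg : dEquiv p k '' (z +ᵥ A) = dEquiv p k z +ᵥ dEquiv p k '' A := by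
    rw [← Set.image_vadd, ← Set.image_vadd, Set.image_image, Set.image_image]
    exact Set.image_congr fun b _ => by simp only [vadd_eq_add, map_add]
  rw [himg, IntegralStructure.haar_vadd]

omit [DecidableEq I] [∀ (i : I), IsUltrametricDist (k i)] in
/-- Admissibility is translation-invariant: `PacketAdm A → PacketAdm (z + A)`. [folklore] -/
theorem packetAdm_vadd (z : PacketAlgebra p k) {A : Set (PacketAlgebra p k)}
    (hA : PacketAdm p k A) : PacketAdm p k (z +ᵥ A) := by
  unfold PacketAdm at hA ⊢
  rw [packetVol_vadd]
  exact hA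

omit [Fintype I] [DecidableEq I] [∀ (i : I), IsUltrametricDist (k i)]
  [∀ (i : I), ProperSpace (k i)] in
/-- Both difference directions between `(R_I)^∼` and its additive translate by a non-element are
nonempty (`0` on the one side, the translating point on the other — the translate is a disjoint
coset of the additive subgroup). [folklore] -/
theorem normalizedPacket_diff_vadd_nonempty {z : PacketAlgebra p k}
    (hz : z ∉ (normalizedPacket p k : Set (PacketAlgebra p k))) :
    ((normalizedPacket p k : Set (PacketAlgebra p k)) \
        (z +ᵥ (normalizedPacket p k : Set (PacketAlgebra p k)))).Nonempty ∧
      ((z +ᵥ (normalizedPacket p k : Set (PacketAlgebra p k))) \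
        (normalizedPacket p k : Set (PacketAlgebra p k))).Nonempty := by
  constructor
  · refine ⟨0, (normalizedPacket p k).zero_mem, ?_⟩
    rintro ⟨b, hb, hb0⟩
    simp only [vadd_eq_add] at hb0
    refine hz ?_
    rw [eq_neg_of_add_eq_zero_left hb0]
    exact (normalizedPacket p k).neg_mem hb
  · refine ⟨z, ⟨0, (normalizedPacket p k).zero_mem, ?_⟩, hz⟩
    simp only [vadd_eq_add, add_zero]

/-- The normalised integral tensor packet `(R_I)^∼` is NOT everything: the point `ψ⁻¹(w)` with
`‖w_j‖ > 1` in every factor (the fields `L_j` are nontrivially normed) lies outside it — its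
`ψ`-image is outside the unit polydisc. [folklore] -/
theorem exists_notMem_normalizedPacket [Nonempty I] :
    ∃ z : PacketAlgebra p k, z ∉ (normalizedPacket p k : Set (PacketAlgebra p k)) := by
  have hw : ∀ j : DIdx p k, ∃ x : DFac p k j, 1 < ‖x‖ := fun j =>
    NormedField.exists_one_lt_norm (DFac p k j)
  choose w hw using hw
  refine ⟨(dEquiv p k).symm w, fun hz => ?_⟩
  have himg : dEquiv p k ((dEquiv p k).symm w) ∈
      dEquiv p k '' (normalizedPacket p k : Set (PacketAlgebra p k)) := ⟨_, hz, rfl⟩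
  rw [image_normalizedPacket_eq_coe, coe_piUnitBallStructure] at himg
  rw [AlgEquiv.apply_symm_apply] at himg
  obtain ⟨j₀⟩ : Nonempty (DIdx p k) := nonempty_dIdx p k
  have hj := himg j₀ (mem_univ _)
  rw [Metric.mem_closedBall, dist_zero_right] at hj
  exact absurd hj (not_le.2 (hw j₀))

end PacketTranslate

end Cor312Vol

/-! ## 6. The assembled real setting: no single-Haar reading at `situationDHVol` -/

namespace Thm311

namespace Real

open Cor312Vol Literature.IUT.LogThetaLattice Literature.IUT.LogVolume

variable {F : Type} [Field F] [NumberField F] (X : PilotData F) {logv : PadicLogs F}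
  (hlog : LogvAnalytic logv) (M : Type) [Field M] [NumberField M]
  (archPk : ∀ (j : (thetaIndex X).Label) (vQ : (thetaIndex X).VQ),
    Set ((logShellsDH X logv).Packet j vQ))
  (archSub : ∀ (j : (thetaIndex X).Label) (v : (thetaIndex X).V),
    Set ((logShellsDH X logv).Packet j ((thetaIndex X).over v)))
  (Ψ : ℤ → ∀ v : (thetaIndex X).V, v ∈ (thetaIndex X).Vbad →
    Set ((logShellsDH X logv).StarPacket v))
  (act : ℤ → ∀ v : (thetaIndex X).V, v ∈ (thetaIndex X).Vbad →
    (logShellsDH X logv).StarPacket v → Module.End ℚ ((logShellsDH X logv).StarPacket v))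
  (Mmod : ℤ → ∀ j : (thetaIndex X).LabelStar, Set ((logShellsDH X logv).GlobalPacket j.1))
  (region : ℤ → ∀ j : (thetaIndex X).LabelStar, FinDivisor M → ∀ vQ : (thetaIndex X).VQ,
    Set ((logShellsDH X logv).Packet j.1 vQ))

/-- **The single-Haar «Iff» reading of the capstone is UNSATISFIABLE at the assembled real
setting** (the kit-l. 43 residual `hAdm` at capstone granularity, CLOSED negatively): over any line
`n` of `Thm311.Real.situationDHVol` — the situation of the typed Theorem 3.11 over the real
Dupuy–Hilado log-shells with the VERBATIM container — as soon as some rational prime `pp` carries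
two distinct places `v₁ ≠ v₂` of `F` (every genuine initial Θ-datum: `F ⊋ ℚ`, [IUTchI] Def. 3.1,
has split primes), NO carrier family `W`, integral structures `Λ` and comparison maps `e` — the
exact instance context of the abstract TEAM B capstone `teamB_capstone_of_latticeRealisations`
(p413800) — satisfy its `hAdm` binder at this situation. Witness packet: label `0` over `pp`, the
two constant tuples `v⃗ = (v₁, …)`, `(v₂, …)` as distinct summands, the normalised integral tensor
packet and a disjoint additive translate as incomparable admissible factors. Consequence (honest
reading, nothing reopened): at the real setting the capstone interface is — and must be — the
REALISED-container one (p415747/p417670); the single-Haar «Iff» reading lives at honest single-Haar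
situations such as the `ZMod 4` capstone witness (p416604/p416831).
[claim: Mochizuki2012, status: disputed] [cite: DupuyHilado2025, §2.4.5, Def. 3.6.1] -/
theorem not_singleHaarAdm_situationDHVol (pp : Nat.Primes)
    {v₁ v₂ : (thetaIndex X).Fibre (.inr pp)} (hv : v₁ ≠ v₂) (n : ℤ)
    (W : (thetaIndex X).Label → (thetaIndex X).VQ → Type*)
    [∀ j vQ, AddCommGroup (W j vQ)] [∀ j vQ, TopologicalSpace (W j vQ)]
    [∀ j vQ, IsTopologicalAddGroup (W j vQ)] [∀ j vQ, MeasurableSpace (W j vQ)]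
    [∀ j vQ, BorelSpace (W j vQ)] (Λ : ∀ j vQ, IntegralStructure (W j vQ))
    (e : ∀ j vQ, (logShellsDH X logv).Packet j vQ → W j vQ) :
    ¬ (∀ (j : (thetaIndex X).Label) (vQ : (thetaIndex X).VQ)
        (A : Set ((logShellsDH X logv).Packet j vQ)),
      ((situationDHVol X hlog M archPk archSub Ψ act Mmod region).D n).Adm j vQ A ↔
        0 < (Λ j vQ).haar (e j vQ '' A) ∧ (Λ j vQ).haar (e j vQ '' A) < ⊤) := by
  classical
  haveI : Fact (pp : ℕ).Prime := ⟨pp.2⟩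
  set P : PadicPresentation (logShellsDH X logv) (.inr pp) pp.1 :=
    padicPresentationDH X pp.1 logv (hlog pp)
  have hz : ∀ e' : (thetaIndex X).Caps 0 → (thetaIndex X).Fibre (.inr pp),
      ∃ z : PacketAlgebra pp.1 (P.kk e'),
        z ∉ (normalizedPacket pp.1 (P.kk e') : Set (PacketAlgebra pp.1 (P.kk e'))) :=
    fun e' => exists_notMem_normalizedPacket pp.1 (P.kk e')
  choose z hz using hz
  set e₁' : (thetaIndex X).Caps 0 → (thetaIndex X).Fibre (.inr pp) := fun _ => v₁ with he₁
  set e₂' : (thetaIndex X).Caps 0 → (thetaIndex X).Fibre (.inr pp) := fun _ => v₂ with he₂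
  have hS₁ := (normalizedPacket_diff_vadd_nonempty pp.1 (P.kk e₁') (hz e₁')).1
  have hS₂ := (normalizedPacket_diff_vadd_nonempty pp.1 (P.kk e₂') (hz e₂')).2
  refine SummandPieces.not_singleHaarAdm_of_realizes
    (realizes_situationDHVol X hlog M archPk archSub Ψ act Mmod region n)
    (j := 0) (vQ := .inr pp) (e₁ := e₁') (e₂ := e₂')
    (R₁ := fun e' => (normalizedPacket pp.1 (P.kk e') : Set (PacketAlgebra pp.1 (P.kk e'))))
    (R₂ := fun e' => z e' +ᵥ
      (normalizedPacket pp.1 (P.kk e') : Set (PacketAlgebra pp.1 (P.kk e'))))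
    ?_ ?_ ?_ hS₁ hS₂ W Λ e
  · intro h
    have h0 := congrFun h (⟨0, Nat.succ_pos _⟩ : (thetaIndex X).Caps 0)
    rw [he₁, he₂] at h0
    exact hv h0
  · intro e'
    exact packetAdm_normalizedPacket pp.1 (P.kk e')
  · intro e'
    exact packetAdm_vadd pp.1 (P.kk e') (z e') (packetAdm_normalizedPacket pp.1 (P.kk e'))

end Real

end Thm311

end IUTFork

end Summit.ABC

end
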